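import Literature.MathematicalPhysics.QuantumLattice.InfVolFermionStateTorusLimitLocalStability
import Literature.MathematicalPhysics.QuantumLattice.HubbardNNNHoppingLocalHamiltonian
import Literature.MathematicalPhysics.QuantumLattice.HubbardNNNHoppingWindowCertificate
import HarnessLib

/-!
# Charged local stability of torus-limit ground states of the `t–t'` Hubbard model:
# `ω(Ã⋆[H_{Λ'}, Ã]) + c·ω(Ã⋆Ã) ≥ 0` for local `A` of definite charge, `c` an eventual bound on the
# sector-energy difference (pair chemical potential)

Topic `Literature/MathematicalPhysics/QuantumLattice` (family `hubbard`); companion of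
`InfVolFermionStateTorusLimitLocalStability.lean`, which proves the Bratteli–Robinson local
ground-state inequality `ω(Ã⋆[H, Ã]) ≥ 0` for torus limits of SECTOR ground states of the
nearest-neighbour Hubbard tori and for local `A` that CONSERVE the local particle number and `S^z`
(canonical limits: only gauge-invariant perturbations are licensed). This file proves the extension
the certified-observable programme needs for its "charged ground-state-positivity" rows
(cell `hubbard-obs`, TARGET §4 F-C: "for a true ground state of `K = H − μN` every local `C` obeys
`ω(C†[K, C]) ≥ 0`; for `C = Φ_x` (charge `−2`) this reads `ω(Φ†[h,Φ]) + 2μ ω(Φ†Φ) ≥ 0` and is implied,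
as a convex constraint, by its version with `μ` replaced by a certified `μ_hi ≥ μ`"), and at the same
time the `t–t'` (next-nearest-neighbour) version of the neutral statement, which the tree did not have:

Let `ψ_L` be ground states of `hubbardTorusTT' L t t' U` in joint sectors `(N_L, S^z = M_L)` of the
fermionic tori `(ℤ/Lℤ)²`, `ω` a torus limit of their translation averages along `Ls → ∞`
(`InfVolFermionState.IsTorusLimitOf`), and `A ∈ 𝔄_Λ` a local observable of DEFINITE CHARGE:
`N_Λ A = A N_Λ − q A`, `S^z_Λ A = A S^z_Λ − s A` (so `A` lowers the particle number by `q` and `S^z` by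
`s`; `q = s = 0` is the gauge-invariant case; the singlet pair `Φ_x` has `q = 2`, `s = 0`; `Φ_x†` has
`q = −2`). If `c ∈ ℝ` bounds the sector-energy differences EVENTUALLY along the sequence,
`E₀(L_j; N_j, M_j) − E₀(L_j; N_j − q, M_j − s) ≤ c` (`E₀(L; N, M) = minEnergyOn (szSector N M)`), then
for every window `Λ' ⊇ thicken Λ 1`

  `0 ≤ ω( Ã⋆ (H_{Λ'} Ã − Ã H_{Λ'}) + c · Ã⋆ Ã )`,   `Ã = A` embedded in `𝔄_{Λ'}`,
  `H_{Λ'} = (hubbardTTPrimeFermionInteraction t t' U).localHamiltonian Λ'`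

(`InfVolFermionState.IsTorusLimitOf.chargedStability_TT'`). Mechanism (finite volume, one line):
`⟨ψ, B⋆[H_L, B] ψ⟩ = ⟨Bψ, (H_L − E₀(N,M)) Bψ⟩ ≥ (E₀(N−q, M−s) − E₀(N,M)) ‖Bψ‖²` because `Bψ` lies in the
sector `(N − q, M − s)` (`star_dotProduct_chargedStability_nonneg`); the torus commutator is the embedded
local commutator (`hubbardTorusTT'_commutator_fermionEmbed`); average over translations; pass to the
limit. Reading for the pair case: with `A = Φ_x` (`q = 2`) the hypothesis is
`(E₀(N_j) − E₀(N_j − 2))/2 ≤ μ_hi` eventually — an upper bound on the finite-volume PAIR-REMOVAL chemical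
potential — and the conclusion is `ω(Φ̃⋆[H_{Λ'}, Φ̃]) + 2μ_hi ω(Φ̃⋆Φ̃) ≥ 0`; with `A = Φ_x†` (`q = −2`) and
`μ_lo ≤ (E₀(N_j + 2) − E₀(N_j))/2` eventually one gets `ω(Φ̃ [H_{Λ'}, Φ̃⋆]) − 2μ_lo ω(Φ̃ Φ̃⋆) ≥ 0`.
HONEST SCOPE: the hypothesis is on FINITE-VOLUME sector-energy differences along the sequence; this
file does not derive it from thermodynamic-limit chemical potentials `μ±(n)` (finite-volume `E₀(L, ·)`
need not be convex in `N`; that bracket has to be certified on the tori or carried as a hypothesis).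
Corollaries: `…localStability_TT'` (the neutral case `q = s = 0`, `c = 0`, for the `t–t'` model; the
nearest-neighbour case is `IsTorusLimitOf.localStability`). Everything is PROVED; no definition, no
named fact.

## References
* O. Bratteli, D. W. Robinson, *Operator Algebras and Quantum Statistical Mechanics 2*, 2nd ed.
  (Springer 1997), Def. 5.3.18, Prop. 5.3.19, Prop. 5.3.25 (ground states and their local stability;
  for the grand-canonical `K = H − μN` the inequality holds for ALL local `A`).
  [cite: BratteliRobinsonII1997, Prop. 5.3.19]
* H. Araki, H. Moriya, *Equilibrium statistical mechanics of fermion lattice systems*,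
  Rev. Math. Phys. 15 (2003) 93, §7 (ground states of fermion lattice systems, variational principle).
  [cite: ArakiMoriya2003, §7]
* M. Araújo, I. Klep, A. J. P. Garner, T. Vértesi, M. Navascués, arXiv:2311.18707, §3.2 Prop. 11
  (state-optimality / KKT constraints in non-commutative polynomial optimisation).
  [cite: AraujoEtAl2023, §3.2 Prop. 11]
* D. Ruelle, *Statistical Mechanics: Rigorous Results* (Benjamin 1969), §3.4 (chemical potential as the
  conjugate of the density; why canonical limits are stable only up to the chemical-potential term).
  [folklore]
-/

noncomputable section

namespace Literature.MathematicalPhysics.QuantumLattice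

open Matrix Finset HubbardWave0 _root_.Filter Literature.Probability.LatticeModels
open scoped _root_.Topology ComplexOrder

/-! ### Finite volume: the charged ground-state inequality between two sectors -/

section FiniteVolume

variable {ι : Type*} [Fintype ι] [DecidableEq ι]

/-- **The charged ground-state inequality.** Let `H` be Hermitian, `K`, `K'` subspaces, `φ ∈ K` an
eigenvector of `H` with eigenvalue the sector energy `minEnergyOn H K`, `B` an operator mapping `K`
into `K'`, and `c` a real number with `minEnergyOn H K − minEnergyOn H K' ≤ c`. Then
`⟨φ, (B⋆(HB − BH) + c B⋆B) φ⟩ = ⟨Bφ, (H − E₀(K) + c) Bφ⟩ ≥ (E₀(K') − E₀(K) + c)‖Bφ‖² ≥ 0`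
(in `ComplexOrder`: real and nonnegative). Bratteli–Robinson II Prop. 5.3.19, finite-dimensional,
between two sectors. [cite: BratteliRobinsonII1997, Prop. 5.3.19] -/
theorem star_dotProduct_chargedStability_nonneg {H B : Matrix ι ι ℂ} (hH : H.IsHermitian)
    (K K' : Submodule ℂ (ι → ℂ)) (hBK : ∀ v ∈ K, B *ᵥ v ∈ K') {φ : ι → ℂ} (hφK : φ ∈ K)
    (hφ : H *ᵥ φ = ((H.minEnergyOn K : ℝ) : ℂ) • φ) {c : ℝ}
    (hc : H.minEnergyOn K - H.minEnergyOn K' ≤ c) :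
    0 ≤ star φ ⬝ᵥ ((Bᴴ * (H * B - B * H) + (c : ℂ) • (Bᴴ * B)) *ᵥ φ) := by
  have h1 : star φ ⬝ᵥ ((Bᴴ * (H * B - B * H)) *ᵥ φ) =
      star (B *ᵥ φ) ⬝ᵥ (H *ᵥ (B *ᵥ φ)) - ((H.minEnergyOn K : ℝ) : ℂ) * (star (B *ᵥ φ) ⬝ᵥ (B *ᵥ φ)) := by
    rw [← mulVec_mulVec, sub_mulVec, ← mulVec_mulVec, ← mulVec_mulVec, hφ, mulVec_smul, dotProduct_mulVec,
      ← star_mulVec, dotProduct_sub, dotProduct_smul, smul_eq_mul]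
  have h2 : star φ ⬝ᵥ ((Bᴴ * B) *ᵥ φ) = star (B *ᵥ φ) ⬝ᵥ (B *ᵥ φ) := by
    rw [← mulVec_mulVec, dotProduct_mulVec, ← star_mulVec]
  have hexp : star φ ⬝ᵥ ((Bᴴ * (H * B - B * H) + (c : ℂ) • (Bᴴ * B)) *ᵥ φ) =
      star (B *ᵥ φ) ⬝ᵥ (H *ᵥ (B *ᵥ φ)) - ((H.minEnergyOn K : ℝ) : ℂ) * (star (B *ᵥ φ) ⬝ᵥ (B *ᵥ φ)) +
        (c : ℂ) * (star (B *ᵥ φ) ⬝ᵥ (B *ᵥ φ)) := by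
    rw [add_mulVec, dotProduct_add, smul_mulVec, dotProduct_smul, smul_eq_mul, h1, h2]
  have hreal : ∀ w : ι → ℂ, (star w ⬝ᵥ (H *ᵥ w)).im = 0 := by
    intro w
    have h : star (star w ⬝ᵥ (H *ᵥ w)) = star w ⬝ᵥ (H *ᵥ w) := by
      conv_lhs => rw [star_dotProduct, star_star, star_mulVec, ← dotProduct_mulVec, hH.eq]
    have := congrArg Complex.im h
    rw [Complex.star_def, Complex.conj_im] at this
    linarith
  have hb : (0 : ℂ) ≤ star (B *ᵥ φ) ⬝ᵥ (B *ᵥ φ) := dotProduct_star_self_nonneg _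
  obtain ⟨hbre, hbim⟩ := Complex.nonneg_iff.1 hb
  have hE := minEnergyOn_mul_le_re_rayleigh_of_mem hH K' (hBK φ hφK)
  rw [hexp, Complex.nonneg_iff]
  refine ⟨?_, ?_⟩
  · rw [Complex.add_re, Complex.sub_re, Complex.re_ofReal_mul, Complex.re_ofReal_mul]
    nlinarith
  · rw [Complex.add_im, Complex.sub_im, Complex.im_ofReal_mul, Complex.im_ofReal_mul, hreal, ← hbim,
      mul_zero, mul_zero, sub_zero, add_zero]

/-- **A twisted-commuting operator shifts eigenspaces**: if `T A = A T + κ A` then `A` maps the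
`μ`-eigenspace of `T` into the `(μ + κ)`-eigenspace (ladder-operator bookkeeping; private helper). [folklore] -/
private theorem mulVec_mem_eigenspace_of_mul_eq_add {n : Type*} [Fintype n] [DecidableEq n] {A T : Matrix n n ℂ}
    {κ : ℂ} (h : T * A = A * T + κ • A) {μ : ℂ} {v : n → ℂ}
    (hv : v ∈ Module.End.eigenspace (Matrix.toLin' T) μ) :
    A *ᵥ v ∈ Module.End.eigenspace (Matrix.toLin' T) (μ + κ) := by
  rw [Module.End.mem_eigenspace_iff, Matrix.toLin'_apply] at hv ⊢
  rw [mulVec_mulVec, h, add_mulVec, smul_mulVec, ← mulVec_mulVec, hv, mulVec_smul, add_smul]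

end FiniteVolume

/-! ### Operators of definite charge map joint sectors to shifted joint sectors -/

section Sector

variable {Λ : Type*} [LinearOrder Λ] [Fintype Λ]

/-- **An operator of definite charge `(q, s)` maps the joint sector `(N, M)` into `(N − q, M − s)`**:
if `N̂ A = A N̂ − q A` and `S^z A = A S^z − s A` then `A (szSector N M) ⊆ szSector N' M'` whenever
`N' = N − q` and `M' = M − s` (as complex numbers) — the charge bookkeeping of the number operators
`N_σ = Σ_x n_{xσ}` of Lieb, PRL 62 (1989) 1201, eqs. (1)–(2). [cite: LiebPRL1989, eqs. (1)–(2)] -/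
theorem mulVec_mem_szSector_of_charge {A : Matrix (Finset (Orb Λ)) (Finset (Orb Λ)) ℂ} {q s : ℂ}
    (hN : totalNumber * A = A * totalNumber - q • A)
    (hS : HubbardWave0.spinZ * A = A * HubbardWave0.spinZ - s • A) {N N' : ℕ} {M M' : ℝ}
    (hN' : (N' : ℂ) = (N : ℂ) - q) (hM' : ((M' : ℝ) : ℂ) = ((M : ℝ) : ℂ) - s)
    {v : Fock (Orb Λ)} (hv : v ∈ szSector N M) : A *ᵥ v ∈ szSector N' M' := by
  unfold szSector at hv ⊢
  rw [Submodule.mem_inf] at hv ⊢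
  have hS' : HubbardWave0.spinZ * A = A * HubbardWave0.spinZ + (-s) • A := by rw [hS, neg_smul, sub_eq_add_neg]
  refine ⟨?_, ?_⟩
  · have h1 := hv.1
    rw [nParticleSubmodule_eq_eigenspace_holds] at h1 ⊢
    have hN'' : (totalNumberOp : Matrix (Finset (Orb Λ)) (Finset (Orb Λ)) ℂ) * A =
        A * totalNumberOp + (-q) • A := by
      rw [totalNumberOp_eq_totalNumber, hN, neg_smul, sub_eq_add_neg]
    have h2 := mulVec_mem_eigenspace_of_mul_eq_add hN'' h1
    rwa [← sub_eq_add_neg, ← hN'] at h2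
  · have h2 := mulVec_mem_eigenspace_of_mul_eq_add hS' hv.2
    rwa [← sub_eq_add_neg, ← hM'] at h2

end Sector

/-! ### Transfer of the charge relations from a region to the torus -/

section Torus

variable {d : ℕ} (L : ℕ) [NeZero L]

/-- **Twisted commutation with a sum of site-local even terms transfers to the torus.** If
`g a ∈ 𝔄⁺({a})` for every torus site `a`, `Γ` maps the local terms `gloc` to `g` on the image, and
`(Σ_p gloc p) A = A (Σ_p gloc p) + κ A`, then `(Σ_a g a) Γ A = Γ A (Σ_a g a) + κ Γ A` (the image part is
`Γ(Σ gloc)`, the rest is even and far from the image, hence commutes with `Γ A`).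
[cite: BratteliRobinsonII1997, §5.2.2] -/
theorem fermionEmbed_toTorusEmb_sum_mul_eq_add {Λ : Finset (Site d)} (h : Set.InjOn (Torus.proj (d := d) L) ↑Λ)
    (A : FermionOp Λ) (g : FermionTorus d L → Matrix (Finset (Orb (FermionTorus d L))) (Finset (Orb (FermionTorus d L))) ℂ)
    (gloc : PolySite Λ → FermionOp Λ) (hg : ∀ a, g a ∈ carEvenSubalgebra (orbs {a}))
    (hgg : ∀ p : PolySite Λ, fermionEmbed (PolySite.toTorusEmb L h) (gloc p) = g (PolySite.toTorusEmb L h p))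
    {κ : ℂ} (hA : (∑ p, gloc p) * A = A * (∑ p, gloc p) + κ • A) :
    (∑ a, g a) * fermionEmbed (PolySite.toTorusEmb L h) A =
      fermionEmbed (PolySite.toTorusEmb L h) A * (∑ a, g a) + κ • fermionEmbed (PolySite.toTorusEmb L h) A := by
  have hι : Set.InjOn (fun x : Site d => FermionTorus.ofTorusSite (Torus.proj L x)) ↑Λ := injOn_ofTorusSite_proj L h
  -- the image part is `Γ(Σ gloc)`
  have himage : ∑ a ∈ Λ.image (fun x => FermionTorus.ofTorusSite (Torus.proj L x)), g a =
      fermionEmbed (PolySite.toTorusEmb L h) (∑ p, gloc p) := by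
    let e : PolySite Λ ≃ {x // x ∈ Λ} :=
      ⟨fun a => ⟨ofLex a.1, PolySite.ofLex_mem a⟩, fun x => PolySite.pt x.1 x.2, fun a => PolySite.pt_ofLex a,
        fun x => Subtype.ext rfl⟩
    rw [Finset.sum_image hι, fermionEmbed_sum, ← Finset.sum_attach Λ, ← Finset.univ_eq_attach]
    refine (Fintype.sum_equiv e _ _ fun a => ?_).symm
    rw [hgg, show PolySite.toTorusEmb L h a = FermionTorus.ofTorusSite (Torus.proj L (e a).1) from rfl]
  -- the rest is even and far from the image
  have hfar : ∑ a ∈ (Λ.image (fun x => FermionTorus.ofTorusSite (Torus.proj L x)))ᶜ, g a ∈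
      carEvenSubalgebra (orbs (Λ.image fun x => FermionTorus.ofTorusSite (Torus.proj L x)))ᶜ := by
    refine sum_mem fun a ha => carEvenSubalgebra_mono (fun i hi => ?_) (hg a)
    rw [mem_orbs, Finset.mem_singleton] at hi
    rw [Finset.mem_compl, mem_orbs, hi]
    exact Finset.mem_compl.1 ha
  have hcomm : Commute (∑ a ∈ (Λ.image (fun x => FermionTorus.ofTorusSite (Torus.proj L x)))ᶜ, g a)
      (fermionEmbed (PolySite.toTorusEmb L h) A) :=
    commute_of_mem_carEvenSubalgebra hfar (fermionEmbed_mem_carSubalgebra _ A)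
      (disjoint_compl_left_iff.2 (orbs_map_toTorusEmb_subset L h))
  rw [← Finset.sum_add_sum_compl (Λ.image fun x => FermionTorus.ofTorusSite (Torus.proj L x)), himage,
    Matrix.add_mul, Matrix.mul_add, ← fermionEmbed_mul, hA, fermionEmbed_add, fermionEmbed_mul, fermionEmbed_smul,
    hcomm.eq]
  abel

/-- **An embedded observable of local charge `q` has charge `q` on the torus**:
`N̂_Λ A = A N̂_Λ − q A` implies `N̂_L (Γ A) = (Γ A) N̂_L − q (Γ A)`. [cite: LiebPRL1989, eqs. (1)–(2)] -/
theorem fermionEmbed_toTorusEmb_totalNumber_mul {Λ : Finset (Site d)} (h : Set.InjOn (Torus.proj (d := d) L) ↑Λ)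
    {A : FermionOp Λ} {q : ℂ} (hA : totalNumber * A = A * totalNumber - q • A) :
    (totalNumber : Matrix (Finset (Orb (FermionTorus d L))) (Finset (Orb (FermionTorus d L))) ℂ) *
        fermionEmbed (PolySite.toTorusEmb L h) A =
      fermionEmbed (PolySite.toTorusEmb L h) A * totalNumber - q • fermionEmbed (PolySite.toTorusEmb L h) A := by
  have hA' : (∑ p : PolySite Λ, ∑ σ : Fin 2, numberOp p σ) * A = A * (∑ p : PolySite Λ, ∑ σ : Fin 2, numberOp p σ) + (-q) • A := by
    rw [show (∑ p : PolySite Λ, ∑ σ : Fin 2, numberOp p σ) = (totalNumber : FermionOp Λ) from rfl, hA, neg_smul,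
      sub_eq_add_neg]
  have := fermionEmbed_toTorusEmb_sum_mul_eq_add L h A (fun a => ∑ σ : Fin 2, numberOp a σ) (fun p => ∑ σ : Fin 2, numberOp p σ)
    (fun a => sum_mem fun σ _ => numberOp_mem_carEvenSubalgebra (orb_mem_orbs.2 (Finset.mem_singleton_self a)))
    (fun p => by rw [fermionEmbed_sum, Finset.sum_congr rfl fun σ _ => fermionEmbed_numberOp _ p σ]) hA'
  rw [neg_smul, ← sub_eq_add_neg] at this
  exact this

/-- **An embedded observable of local spin charge `s` has spin charge `s` on the torus**:
`S^z_Λ A = A S^z_Λ − s A` implies `S^z_L (Γ A) = (Γ A) S^z_L − s (Γ A)`. [cite: LiebPRL1989, eqs. (1)–(2)] -/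
theorem fermionEmbed_toTorusEmb_spinZ_mul {Λ : Finset (Site d)} (h : Set.InjOn (Torus.proj (d := d) L) ↑Λ)
    {A : FermionOp Λ} {s : ℂ} (hA : HubbardWave0.spinZ * A = A * HubbardWave0.spinZ - s • A) :
    (HubbardWave0.spinZ : Matrix (Finset (Orb (FermionTorus d L))) (Finset (Orb (FermionTorus d L))) ℂ) *
        fermionEmbed (PolySite.toTorusEmb L h) A =
      fermionEmbed (PolySite.toTorusEmb L h) A * HubbardWave0.spinZ - s • fermionEmbed (PolySite.toTorusEmb L h) A := by
  -- `2 S^z = Σ_p (n_{p↑} - n_{p↓})`, locally and on the torus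
  have h2loc : (2 : ℂ) • (HubbardWave0.spinZ : FermionOp Λ) = ∑ p : PolySite Λ, (numberOp p 0 - numberOp p 1) := by
    rw [HubbardWave0.spinZ, smul_smul, mul_one_div_cancel (two_ne_zero' ℂ), one_smul]
  have h2tor : (2 : ℂ) • (HubbardWave0.spinZ : Matrix (Finset (Orb (FermionTorus d L))) (Finset (Orb (FermionTorus d L))) ℂ) =
      ∑ a : FermionTorus d L, (numberOp a 0 - numberOp a 1) := by
    rw [HubbardWave0.spinZ, smul_smul, mul_one_div_cancel (two_ne_zero' ℂ), one_smul]
  have hA' : (∑ p : PolySite Λ, (numberOp p 0 - numberOp p 1)) * A =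
      A * (∑ p : PolySite Λ, (numberOp p 0 - numberOp p 1)) + (-(2 * s)) • A := by
    rw [← h2loc, Matrix.smul_mul, Matrix.mul_smul, hA, smul_sub, smul_smul, neg_smul, sub_eq_add_neg]
  have hS := fermionEmbed_toTorusEmb_sum_mul_eq_add L h A (fun a => numberOp a 0 - numberOp a 1)
    (fun p => numberOp p 0 - numberOp p 1)
    (fun a => by
      rw [show numberOp a 0 - numberOp a 1 = numberOp a 0 + (-1 : ℂ) • numberOp a 1 by
        rw [neg_one_smul, sub_eq_add_neg]]
      exact add_mem (numberOp_mem_carEvenSubalgebra (orb_mem_orbs.2 (Finset.mem_singleton_self a)))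
        (SMulMemClass.smul_mem _ (numberOp_mem_carEvenSubalgebra (orb_mem_orbs.2 (Finset.mem_singleton_self a)))))
    (fun p => by rw [fermionEmbed_sub, fermionEmbed_numberOp, fermionEmbed_numberOp]) hA'
  rw [← h2tor, Matrix.smul_mul, Matrix.mul_smul] at hS
  -- divide by `2`
  have h3 : (2 : ℂ) • ((HubbardWave0.spinZ : Matrix (Finset (Orb (FermionTorus d L))) (Finset (Orb (FermionTorus d L))) ℂ) *
        fermionEmbed (PolySite.toTorusEmb L h) A) =
      (2 : ℂ) • (fermionEmbed (PolySite.toTorusEmb L h) A * HubbardWave0.spinZ - s • fermionEmbed (PolySite.toTorusEmb L h) A) := by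
    rw [hS, smul_sub, smul_smul, neg_smul, sub_eq_add_neg]
  exact smul_right_injective _ (two_ne_zero' ℂ) h3

/-! ### The charged ground-state inequality on the `t–t'` torus, and in the limit -/

variable (t t' U : ℝ)

/-- **Finite volume, one ground state (`t–t'` model).** For a ground state `φ` of `hubbardTorusTT' L t t' U`
in the joint sector `(N, S^z = M)`, a region `Λ` with window `Λ' ⊇ thicken Λ 1` fitting into the torus
(`x ↦ x mod L` injective on `thicken Λ' 1`), a local observable `A ∈ 𝔄_Λ` of charge `(q, s)`
(`N̂_Λ A = A N̂_Λ − q A`, `S^z_Λ A = A S^z_Λ − s A`), a target sector `(N', M')` with `N' = N − q`, `M' = M − s`,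
and `c ≥ E₀(N, M) − E₀(N', M')`:  `⟨φ, Γ(Ã⋆ [H_{Λ'}, Ã] + c Ã⋆Ã) φ⟩ ≥ 0`.
[cite: BratteliRobinsonII1997, Prop. 5.3.19] -/
theorem expect_fermionEmbed_chargedStability_TT'_nonneg {Λ Λ' : Finset (Site 2)}
    (hΛ : Λ ⊆ Λ') (h8 : thicken Λ 1 ⊆ Λ') {L : ℕ} [NeZero L]
    (hInj : Set.InjOn (Torus.proj (d := 2) L) ↑(thicken Λ' 1)) {N N' : ℕ} {M M' : ℝ}
    {φ : Fock (Orb (FermionTorus 2 L))} (hφ : IsGroundStateInSector (hubbardTorusTT' L t t' U) N M φ)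
    {A : FermionOp Λ} {q s : ℂ} (hAN : totalNumber * A = A * totalNumber - q • A)
    (hAS : HubbardWave0.spinZ * A = A * HubbardWave0.spinZ - s • A)
    (hN' : (N' : ℂ) = (N : ℂ) - q) (hM' : ((M' : ℝ) : ℂ) = ((M : ℝ) : ℂ) - s) {c : ℝ}
    (hc : (hubbardTorusTT' L t t' U).minEnergyOn (szSector N M) -
      (hubbardTorusTT' L t t' U).minEnergyOn (szSector N' M') ≤ c) :
    0 ≤ expect (fermionEmbed (PolySite.toTorusEmb L (hInj.mono (by exact_mod_cast subset_thicken Λ' 1)))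
        ((fermionEmbed (PolySite.incl hΛ) A)ᴴ *
            ((hubbardTTPrimeFermionInteraction t t' U).localHamiltonian Λ' * fermionEmbed (PolySite.incl hΛ) A -
              fermionEmbed (PolySite.incl hΛ) A * (hubbardTTPrimeFermionInteraction t t' U).localHamiltonian Λ') +
          (c : ℂ) • ((fermionEmbed (PolySite.incl hΛ) A)ᴴ * fermionEmbed (PolySite.incl hΛ) A))) φ := by
  have hΛinj : Set.InjOn (Torus.proj (d := 2) L) ↑Λ :=
    hInj.mono (by exact_mod_cast hΛ.trans (subset_thicken Λ' 1))
  rw [expect, fermionEmbed_add, fermionEmbed_smul, fermionEmbed_mul, fermionEmbed_mul, fermionEmbed_conjTranspose,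
    ← hubbardTorusTT'_commutator_fermionEmbed L t t' U hΛ h8 hInj A]
  -- the embedded observable, as an embedding of `Λ` itself
  have hB : fermionEmbed (PolySite.toTorusEmb L (hInj.mono (by exact_mod_cast subset_thicken Λ' 1)))
      (fermionEmbed (PolySite.incl hΛ) A) = fermionEmbed (PolySite.toTorusEmb L hΛinj) A := by
    rw [fermionEmbed_fermionEmbed]
    exact congrFun (congrArg DFunLike.coe (fermionEmbed_congr fun p => rfl)) A
  rw [hB]
  exact star_dotProduct_chargedStability_nonneg (hubbardTorusTT'_isHermitian L t t' U) (szSector N M) (szSector N' M')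
    (fun v hv => mulVec_mem_szSector_of_charge (fermionEmbed_toTorusEmb_totalNumber_mul L hΛinj hAN)
      (fermionEmbed_toTorusEmb_spinZ_mul L hΛinj hAS) hN' hM' hv) hφ.1 hφ.2.2 hc

/-- **Finite volume, translation average (`t–t'` model).** The translation-averaged torus expectation of
`Ã⋆[H_{Λ'}, Ã] + c Ã⋆Ã` in a sector ground state is `≥ 0` (every translate of a ground state is a ground
state of the translation-invariant `hubbardTorusTT'`, `relabel_translate_hubbardTorusTT'`).
[cite: BratteliRobinsonII1997, Prop. 5.3.19] -/
theorem torusAvgExpectAt_chargedStability_TT'_nonneg {Λ Λ' : Finset (Site 2)}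
    (hΛ : Λ ⊆ Λ') (h8 : thicken Λ 1 ⊆ Λ') {L : ℕ} [NeZero L]
    (hInj : Set.InjOn (Torus.proj (d := 2) L) ↑(thicken Λ' 1)) {N N' : ℕ} {M M' : ℝ}
    {ψ : Fock (Orb (FermionTorus 2 L))} (hψ : IsGroundStateInSector (hubbardTorusTT' L t t' U) N M ψ)
    {A : FermionOp Λ} {q s : ℂ} (hAN : totalNumber * A = A * totalNumber - q • A)
    (hAS : HubbardWave0.spinZ * A = A * HubbardWave0.spinZ - s • A)
    (hN' : (N' : ℂ) = (N : ℂ) - q) (hM' : ((M' : ℝ) : ℂ) = ((M : ℝ) : ℂ) - s) {c : ℝ}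
    (hc : (hubbardTorusTT' L t t' U).minEnergyOn (szSector N M) -
      (hubbardTorusTT' L t t' U).minEnergyOn (szSector N' M') ≤ c) :
    0 ≤ torusAvgExpectAt L Λ'
        ((fermionEmbed (PolySite.incl hΛ) A)ᴴ *
            ((hubbardTTPrimeFermionInteraction t t' U).localHamiltonian Λ' * fermionEmbed (PolySite.incl hΛ) A -
              fermionEmbed (PolySite.incl hΛ) A * (hubbardTTPrimeFermionInteraction t t' U).localHamiltonian Λ') +
          (c : ℂ) • ((fermionEmbed (PolySite.incl hΛ) A)ᴴ * fermionEmbed (PolySite.incl hΛ) A)) ψ := by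
  have h₁ : Set.InjOn (Torus.proj (d := 2) L) ↑Λ' := hInj.mono (by exact_mod_cast subset_thicken Λ' 1)
  rw [torusAvgExpectAt_of_injOn L h₁]
  have hsum : (0 : ℂ) ≤ ∑ v : TorusSite 2 L, expect (fermionEmbed (PolySite.toTorusEmb L h₁)
      ((fermionEmbed (PolySite.incl hΛ) A)ᴴ *
            ((hubbardTTPrimeFermionInteraction t t' U).localHamiltonian Λ' * fermionEmbed (PolySite.incl hΛ) A -
              fermionEmbed (PolySite.incl hΛ) A * (hubbardTTPrimeFermionInteraction t t' U).localHamiltonian Λ') +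
          (c : ℂ) • ((fermionEmbed (PolySite.incl hΛ) A)ᴴ * fermionEmbed (PolySite.incl hΛ) A)))
      ((fockTranslate v).val *ᵥ ψ) :=
    Finset.sum_nonneg fun v _ => expect_fermionEmbed_chargedStability_TT'_nonneg t t' U hΛ h8 hInj
      (hψ.fockTranslate_mulVec v (relabel_translate_hubbardTorusTT' L v t t' U)) hAN hAS hN' hM' hc
  obtain ⟨hre, him⟩ := Complex.nonneg_iff.1 hsum
  rw [show ((Fintype.card (TorusSite 2 L) : ℂ))⁻¹ = (((Fintype.card (TorusSite 2 L) : ℝ)⁻¹ : ℝ) : ℂ) by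
    push_cast; rfl, Complex.nonneg_iff, Complex.re_ofReal_mul, Complex.im_ofReal_mul, ← him, mul_zero]
  exact ⟨mul_nonneg (inv_nonneg.2 (Nat.cast_nonneg _)) hre, rfl⟩

/-- **Charged local stability of torus-limit states (`t–t'` Hubbard model).** Let `ω` be a torus limit
of the translation averages of sector ground states `ψ_{Ls j}` of `hubbardTorusTT' (Ls j) t t' U` (sectors
`(N_j, S^z = M_j)`), `Ls → ∞`; let `A ∈ 𝔄_Λ` have charge `(q, s)` (`N̂_Λ A = A N̂_Λ − q A`,
`S^z_Λ A = A S^z_Λ − s A`), let `(N'_j, M'_j) = (N_j − q, M_j − s)` be the target sectors, and let `c ∈ ℝ`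
satisfy EVENTUALLY `E₀(Ls j; N_j, M_j) − E₀(Ls j; N'_j, M'_j) ≤ c`. Then for every window `Λ' ⊇ thicken Λ 1`,
`0 ≤ ω(Ã⋆ [H_{Λ'}, Ã] + c Ã⋆Ã)` (`Ã = A` embedded in `𝔄_{Λ'}`): the state cannot lower its energy by
the local perturbation `A` once the sector-energy difference `c` is paid — for `A = Φ_x` (`q = 2`, `s = 0`,
`c = 2μ_hi`) this is the charged ground-state-positivity row `ω(Φ̃⋆[H,Φ̃]) + 2μ_hi ω(Φ̃⋆Φ̃) ≥ 0`.
Bratteli–Robinson II Prop. 5.3.19/5.3.25 (grand-canonical form); Araújo et al. (2023) Prop. 11.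
[cite: BratteliRobinsonII1997, Prop. 5.3.25] -/
theorem InfVolFermionState.IsTorusLimitOf.chargedStability_TT' {ω : InfVolFermionState 2}
    {ψ : ∀ L, Fock (Orb (FermionTorus 2 L))} {Ls : ℕ → ℕ} (h : ω.IsTorusLimitOf ψ Ls)
    (hLs : Tendsto Ls atTop atTop) {N N' : ℕ → ℕ} {M M' : ℕ → ℝ}
    (hgs : ∀ j, IsGroundStateInSector (hubbardTorusTT' (Ls j) t t' U) (N j) (M j) (ψ (Ls j)))
    {Λ Λ' : Finset (Site 2)} (hΛ : Λ ⊆ Λ') (h8 : thicken Λ 1 ⊆ Λ')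
    {A : FermionOp Λ} {q s : ℂ} (hAN : totalNumber * A = A * totalNumber - q • A)
    (hAS : HubbardWave0.spinZ * A = A * HubbardWave0.spinZ - s • A)
    (hN' : ∀ j, (N' j : ℂ) = (N j : ℂ) - q) (hM' : ∀ j, ((M' j : ℝ) : ℂ) = ((M j : ℝ) : ℂ) - s) {c : ℝ}
    (hc : ∀ᶠ j in atTop, (hubbardTorusTT' (Ls j) t t' U).minEnergyOn (szSector (N j) (M j)) -
      (hubbardTorusTT' (Ls j) t t' U).minEnergyOn (szSector (N' j) (M' j)) ≤ c) :
    0 ≤ ω.expect Λ'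
        ((fermionEmbed (PolySite.incl hΛ) A)ᴴ *
            ((hubbardTTPrimeFermionInteraction t t' U).localHamiltonian Λ' * fermionEmbed (PolySite.incl hΛ) A -
              fermionEmbed (PolySite.incl hΛ) A * (hubbardTTPrimeFermionInteraction t t' U).localHamiltonian Λ') +
          (c : ℂ) • ((fermionEmbed (PolySite.incl hΛ) A)ᴴ * fermionEmbed (PolySite.incl hΛ) A)) := by
  refine ge_of_tendsto (h Λ' _) ?_
  filter_upwards [eventually_injOn_proj_of_tendsto (thicken Λ' 1) hLs, hLs.eventually_ge_atTop 1, hc]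
    with j hInj hj hcj
  haveI : NeZero (Ls j) := ⟨by omega⟩
  rw [torusAvgExpect_eq]
  exact torusAvgExpectAt_chargedStability_TT'_nonneg t t' U hΛ h8 hInj (hgs j) hAN hAS (hN' j) (hM' j) hcj

/-- **Neutral local stability of torus-limit states of the `t–t'` model** (the case `q = s = 0`, `c = 0`):
for every local `A ∈ 𝔄_Λ` conserving the local particle number and `S^z` and every window
`Λ' ⊇ thicken Λ 1`, `0 ≤ ω(Ã⋆ [H_{Λ'}, Ã])` — the `t–t'` counterpart of `IsTorusLimitOf.localStability`.
[cite: BratteliRobinsonII1997, Prop. 5.3.25] -/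
theorem InfVolFermionState.IsTorusLimitOf.localStability_TT' {ω : InfVolFermionState 2}
    {ψ : ∀ L, Fock (Orb (FermionTorus 2 L))} {Ls : ℕ → ℕ} (h : ω.IsTorusLimitOf ψ Ls)
    (hLs : Tendsto Ls atTop atTop) {N : ℕ → ℕ} {M : ℕ → ℝ}
    (hgs : ∀ j, IsGroundStateInSector (hubbardTorusTT' (Ls j) t t' U) (N j) (M j) (ψ (Ls j)))
    {Λ Λ' : Finset (Site 2)} (hΛ : Λ ⊆ Λ') (h8 : thicken Λ 1 ⊆ Λ')
    {A : FermionOp Λ} (hAN : Commute A totalNumber) (hAS : Commute A HubbardWave0.spinZ) :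
    0 ≤ ω.expect Λ'
        ((fermionEmbed (PolySite.incl hΛ) A)ᴴ *
            ((hubbardTTPrimeFermionInteraction t t' U).localHamiltonian Λ' * fermionEmbed (PolySite.incl hΛ) A -
              fermionEmbed (PolySite.incl hΛ) A * (hubbardTTPrimeFermionInteraction t t' U).localHamiltonian Λ')) := by
  have hAN' : totalNumber * A = A * totalNumber - (0 : ℂ) • A := by rw [zero_smul, sub_zero, hAN.eq]
  have hAS' : HubbardWave0.spinZ * A = A * HubbardWave0.spinZ - (0 : ℂ) • A := by rw [zero_smul, sub_zero, hAS.eq]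
  have key := h.chargedStability_TT' t t' U hLs (N' := N) (M' := M) hgs hΛ h8 hAN' hAS'
    (fun j => by rw [sub_zero]) (fun j => by rw [sub_zero]) (c := 0)
    (Eventually.of_forall fun j => by rw [sub_self])
  rwa [Complex.ofReal_zero, zero_smul, add_zero] at key

/-- **The pair-removal case** (`q = 2`, `s = 0`; e.g. `A = Φ_x`, a singlet pair annihilator): if
`A` lowers the local particle number by `2` and commutes with the local `S^z`, `2 ≤ N_j`, and the
finite-volume PAIR-REMOVAL chemical potentials satisfy EVENTUALLY
`(E₀(Ls j; N_j, M_j) − E₀(Ls j; N_j − 2, M_j))/2 ≤ μhi`, then for every window `Λ' ⊇ thicken Λ 1`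
`0 ≤ ω(Ã⋆ [H_{Λ'}, Ã] + 2μhi · Ã⋆Ã)` — the charged ground-state-positivity row of the certified-observable
programme with `μ` replaced by an upper bound `μhi` of the pair chemical potential (sound because
`ω(Ã⋆Ã) ≥ 0`). [cite: BratteliRobinsonII1997, Prop. 5.3.25] -/
theorem InfVolFermionState.IsTorusLimitOf.chargedStability_TT'_pair {ω : InfVolFermionState 2}
    {ψ : ∀ L, Fock (Orb (FermionTorus 2 L))} {Ls : ℕ → ℕ} (h : ω.IsTorusLimitOf ψ Ls)
    (hLs : Tendsto Ls atTop atTop) {N : ℕ → ℕ} {M : ℕ → ℝ}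
    (hgs : ∀ j, IsGroundStateInSector (hubbardTorusTT' (Ls j) t t' U) (N j) (M j) (ψ (Ls j)))
    (hN2 : ∀ j, 2 ≤ N j)
    {Λ Λ' : Finset (Site 2)} (hΛ : Λ ⊆ Λ') (h8 : thicken Λ 1 ⊆ Λ')
    {A : FermionOp Λ} (hAN : totalNumber * A = A * totalNumber - (2 : ℂ) • A)
    (hAS : Commute A HubbardWave0.spinZ) {μhi : ℝ}
    (hμ : ∀ᶠ j in atTop, ((hubbardTorusTT' (Ls j) t t' U).minEnergyOn (szSector (N j) (M j)) -
      (hubbardTorusTT' (Ls j) t t' U).minEnergyOn (szSector (N j - 2) (M j))) / 2 ≤ μhi) :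
    0 ≤ ω.expect Λ'
        ((fermionEmbed (PolySite.incl hΛ) A)ᴴ *
            ((hubbardTTPrimeFermionInteraction t t' U).localHamiltonian Λ' * fermionEmbed (PolySite.incl hΛ) A -
              fermionEmbed (PolySite.incl hΛ) A * (hubbardTTPrimeFermionInteraction t t' U).localHamiltonian Λ') +
          ((2 * μhi : ℝ) : ℂ) • ((fermionEmbed (PolySite.incl hΛ) A)ᴴ * fermionEmbed (PolySite.incl hΛ) A)) := by
  have hAS' : HubbardWave0.spinZ * A = A * HubbardWave0.spinZ - (0 : ℂ) • A := by rw [zero_smul, sub_zero, hAS.eq]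
  refine h.chargedStability_TT' t t' U hLs (N' := fun j => N j - 2) (M' := M) hgs hΛ h8 hAN hAS'
    (fun j => ?_) (fun j => by rw [sub_zero]) ?_
  · simp only [Nat.cast_sub (hN2 j), Nat.cast_ofNat]
  · filter_upwards [hμ] with j hj
    linarith

end Torus

end Literature.MathematicalPhysics.QuantumLattice

end
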